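import Literature.NumberTheory.EllipticCurves.PAdicLFunctionInterpolationProofs
import HarnessLib

/-!
# Additive ball-value systems on `ℤ_p`: fibres of `ℤ/p^{n+1} → ℤ/pⁿ` in parametrised and filtered
# form, iterated additivity, reduction to a lower level on units — generic bookkeeping for the
# Γ-pushforward of the untwisted Mazur–Tate–Teitelbaum system (route CyclotomicUntwist, D1/F1)

Cell `pub/bsd-wall` (D-0145 line `route-BirchSwinnertonDyer-CyclotomicUntwist`), seat `bsd-line-cycu-p1`
(prover seat 1/3, K1 base), helper toward crux K1 `PSRankOneLowerHalfAtThree`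
(stmt-BirchSwinnertonDyer-21580). THEOREMS ONLY (no definition, no named fact, no `sorry`); BSD is not
proved by this file and no crux is.

The tree's `PAdicLFunctionInterpolationProofs` proves the iterated distribution relation and the
level-reduction-on-units for the SPECIFIC system `msdMeasure f α` (good ordinary case). The untwisted
system of `CyclotomicUntwistUntwistedSymbolSystem` is a `ℂ_p`-valued system given by hypotheses; this file
restates that bookkeeping for a `ℂ_p`-VALUED system `μ : (n : ℕ) → ℤ/pⁿ → ℂ_p` additive in the filtered sense
(the tree's abstract `PAdicMeasureTransform.sum_fiber_of_distribution` is `ℚ_p`-valued; the untwisted system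
carries `η̄` and `α ∈ ℂ_p`)
(`∑_{b ↦ a} μ_{n+1}(b) = μ_n(a)`), and supplies the bridge from the parametrised fibre
`j ↦ ã + pⁿ j̃` (`ZMod (p^1)`) used by `PSUntwistedSystem.fibreSum_nu_eq` to the filtered fibre used by D1's
`IsGammaDistribution` and by the tree's class machinery (`finsum_sum_classes_eq_sum_units`):
* `sum_filter_castHom_eq_sum_param` — `∑_{b : b mod pⁿ = a} g(b) = ∑_{j mod p} g(ã + pⁿ j̃)`;
* `sum_fiber_add_of_additive` / `sum_fiber_le_of_additive` — iterated additivity `∑_{b : b mod pⁿ = a} μ_L(b) = μ_n(a)`;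
* `sum_units_mul_of_additive` — `∑_{u ∈ (ℤ/p^L)ˣ} μ_L(u) g(u mod p^m) = ∑_{a ∈ (ℤ/p^m)ˣ} μ_m(a) g(a)`
  (`1 ≤ m ≤ L`);
* `sum_mul_comp_castHom_of_additive` — `∑_{y mod p^L} G(y mod pⁿ) μ_L(y) = ∑_{x mod pⁿ} G(x) μ_n(x)`.
All [folklore]; proofs follow the tree's `sum_fiber_msdMeasure` / `sum_units_msdMeasure_mul` verbatim with
`msdMeasure f α` replaced by `μ`.

References: [cite: MazurTateTeitelbaum1986Invent, §I.10–§I.11 (distribution relation) and §I.13].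
-/

noncomputable section

open Literature.NumberTheory.EllipticCurves

-- single-conjunct summit: `Summit.BirchSwinnertonDyer.BirchSwinnertonDyer.…` repeats the name by design
set_option linter.dupNamespace false
set_option autoImplicit false

namespace Summit.BirchSwinnertonDyer.BirchSwinnertonDyer.Theorems.PSBallSystems

variable {p : ℕ} [Fact p.Prime]

/-! ### §1 The fibre of `ℤ/p^{n+1} → ℤ/pⁿ` over `a`: `{ã + pⁿ j̃ : j mod p}` -/

section Fibre

variable {n : ℕ}

/-- The canonical lift of a fibre point is its own residue: `ã + pⁿ j̃ < p^{n+1}`. [folklore] -/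
theorem val_natCast_fibre (a : ZMod (p ^ n)) (j : ZMod (p ^ 1)) :
    (((a.val + p ^ n * j.val : ℕ) : ZMod (p ^ (n + 1)))).val = a.val + p ^ n * j.val := by
  haveI : NeZero (p ^ n) := ⟨pow_ne_zero _ (Fact.out : p.Prime).ne_zero⟩
  haveI : NeZero (p ^ 1) := ⟨pow_ne_zero _ (Fact.out : p.Prime).ne_zero⟩
  apply ZMod.val_natCast_of_lt
  have hx := ZMod.val_lt a
  have hj : j.val < p := lt_of_lt_of_eq (ZMod.val_lt j) (pow_one p)
  calc a.val + p ^ n * j.val < p ^ n + p ^ n * j.val := by omega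
    _ = p ^ n * (j.val + 1) := by ring
    _ ≤ p ^ n * p := Nat.mul_le_mul_left _ hj
    _ = p ^ (n + 1) := (pow_succ p n).symm

/-- The fibre point reduces to `a`. [folklore] -/
theorem castHom_natCast_fibre (a : ZMod (p ^ n)) (j : ZMod (p ^ 1)) :
    ZMod.castHom (pow_dvd_pow p n.le_succ) (ZMod (p ^ n)) ((a.val + p ^ n * j.val : ℕ) : ZMod (p ^ (n + 1))) =
      a := by
  haveI : NeZero (p ^ n) := ⟨pow_ne_zero _ (Fact.out : p.Prime).ne_zero⟩
  have hpn : ((p : ZMod (p ^ n)) ^ n) = 0 := by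
    rw [← Nat.cast_pow, ZMod.natCast_self]
  rw [map_natCast, Nat.cast_add, Nat.cast_mul, Nat.cast_pow, ZMod.natCast_zmod_val, hpn, zero_mul,
    add_zero]

/-- A point `b` over `a` is the fibre point of `j = (b̃ / pⁿ) mod p`. [folklore] -/
theorem natCast_fibre_of_castHom_eq {a : ZMod (p ^ n)} {b : ZMod (p ^ (n + 1))}
    (hb : ZMod.castHom (pow_dvd_pow p n.le_succ) (ZMod (p ^ n)) b = a) :
    ((a.val + p ^ n * (((b.val / p ^ n : ℕ) : ZMod (p ^ 1))).val : ℕ) : ZMod (p ^ (n + 1))) = b := by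
  haveI : NeZero (p ^ n) := ⟨pow_ne_zero _ (Fact.out : p.Prime).ne_zero⟩
  haveI : NeZero (p ^ (n + 1)) := ⟨pow_ne_zero _ (Fact.out : p.Prime).ne_zero⟩
  haveI : NeZero (p ^ 1) := ⟨pow_ne_zero _ (Fact.out : p.Prime).ne_zero⟩
  have hp : p.Prime := Fact.out
  have ha : a.val = b.val % p ^ n := by
    rw [← hb, ZMod.castHom_apply, ZMod.cast_eq_val, ZMod.val_natCast]
  have hq : b.val / p ^ n < p := by
    rw [Nat.div_lt_iff_lt_mul (pow_pos hp.pos n)]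
    calc b.val < p ^ (n + 1) := ZMod.val_lt b
      _ = p * p ^ n := by rw [pow_succ, mul_comm]
  rw [ZMod.val_natCast_of_lt (lt_of_lt_of_eq hq (pow_one p).symm), ha, Nat.mod_add_div,
    ZMod.natCast_zmod_val]

/-- **Filtered fibre = parametrised fibre**: `∑_{b : b mod pⁿ = a} g(b) = ∑_{j mod p} g(ã + pⁿ j̃)`.
[folklore] -/
theorem sum_filter_castHom_eq_sum_param {M : Type*} [AddCommMonoid M] (g : ZMod (p ^ (n + 1)) → M)
    (a : ZMod (p ^ n)) :
    ∑ b ∈ Finset.univ.filter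
        (fun b : ZMod (p ^ (n + 1)) ↦ ZMod.castHom (pow_dvd_pow p n.le_succ) (ZMod (p ^ n)) b = a), g b =
      ∑ j : ZMod (p ^ 1), g ((a.val + p ^ n * j.val : ℕ) : ZMod (p ^ (n + 1))) := by
  classical
  haveI : NeZero (p ^ n) := ⟨pow_ne_zero _ (Fact.out : p.Prime).ne_zero⟩
  haveI : NeZero (p ^ 1) := ⟨pow_ne_zero _ (Fact.out : p.Prime).ne_zero⟩
  have hp : p.Prime := Fact.out
  refine Finset.sum_nbij' (fun b ↦ ((b.val / p ^ n : ℕ) : ZMod (p ^ 1)))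
    (fun j ↦ ((a.val + p ^ n * j.val : ℕ) : ZMod (p ^ (n + 1)))) (fun _ _ ↦ Finset.mem_univ _)
    (fun j _ ↦ ?_) (fun b hb ↦ ?_) (fun j _ ↦ ?_) (fun b hb ↦ ?_)
  · exact Finset.mem_filter.mpr ⟨Finset.mem_univ _, castHom_natCast_fibre a j⟩
  · exact natCast_fibre_of_castHom_eq (Finset.mem_filter.mp hb).2
  · -- `((ã + pⁿ j̃) / pⁿ) mod p = j`
    rw [val_natCast_fibre, Nat.add_mul_div_left _ _ (pow_pos hp.pos n),
      Nat.div_eq_of_lt (ZMod.val_lt a), zero_add, ZMod.natCast_zmod_val]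
  · rw [natCast_fibre_of_castHom_eq (Finset.mem_filter.mp hb).2]

end Fibre

/-! ### §2 Iterated additivity and reduction to a lower level -/

section Additive

variable (μ : (n : ℕ) → ZMod (p ^ n) → ℂ_[p])

/-- **Iterated additivity, `d` steps up**: `∑_{b : b mod pⁿ = a} μ_{n+d}(b) = μ_n(a)`, from the one-step
relation (stated with the level gap `d` explicit; the `ℚ_p`-valued form with `n ≤ L` is the tree's
`sum_fiber_of_distribution`). [cite: MazurTateTeitelbaum1986Invent, §I.10 (10.2)] -/
theorem sum_fiber_add_of_additive
    (hdist : ∀ (n : ℕ) (a : ZMod (p ^ n)),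
      ∑ b ∈ Finset.univ.filter (fun b : ZMod (p ^ (n + 1)) ↦
        ZMod.castHom (pow_dvd_pow p n.le_succ) (ZMod (p ^ n)) b = a), μ (n + 1) b = μ n a)
    (n d : ℕ) (a : ZMod (p ^ n)) :
    ∑ b ∈ Finset.univ.filter (fun b : ZMod (p ^ (n + d)) ↦
      ZMod.castHom (pow_dvd_pow p (Nat.le_add_right n d)) (ZMod (p ^ n)) b = a), μ (n + d) b = μ n a := by
  classical
  induction d with
  | zero =>
    have h0 : ∀ b : ZMod (p ^ (n + 0)),
        ZMod.castHom (pow_dvd_pow p (Nat.le_add_right n 0)) (ZMod (p ^ n)) b = b := fun b ↦ by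
      rw [show ZMod.castHom (pow_dvd_pow p (Nat.le_add_right n 0)) (ZMod (p ^ n)) =
        ZMod.castHom (dvd_refl _) (ZMod (p ^ (n + 0))) from rfl, ZMod.castHom_self, RingHom.id_apply]
    simp_rw [h0]
    rw [Finset.sum_filter]
    simp only [Finset.sum_ite_eq', Finset.mem_univ, if_true]
    rfl
  | succ d ih =>
    rw [← ih, ← Finset.sum_fiberwise_of_maps_to
      (s := Finset.univ.filter (fun b : ZMod (p ^ (n + (d + 1))) ↦
        ZMod.castHom (pow_dvd_pow p (Nat.le_add_right n (d + 1))) (ZMod (p ^ n)) b = a))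
      (t := Finset.univ.filter (fun b : ZMod (p ^ (n + d)) ↦
        ZMod.castHom (pow_dvd_pow p (Nat.le_add_right n d)) (ZMod (p ^ n)) b = a))
      (g := ZMod.castHom (pow_dvd_pow p (n + d).le_succ) (ZMod (p ^ (n + d))))]
    · refine Finset.sum_congr rfl fun y hy ↦ ?_
      rw [← hdist (n + d) y]
      refine Finset.sum_congr ?_ fun _ _ ↦ rfl
      ext x
      simp only [Finset.mem_filter, Finset.mem_univ, true_and, and_iff_right_iff_imp]
      intro hx
      rw [← (Finset.mem_filter.mp hy).2, ← hx, castHom_castHom_zmod]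
    · intro x hx
      simp only [Finset.mem_filter, Finset.mem_univ, true_and] at hx ⊢
      rw [castHom_castHom_zmod]
      exact hx

/-- Iterated additivity with levels `n ≤ L`. [cite: MazurTateTeitelbaum1986Invent, §I.10 (10.2)] -/
theorem sum_fiber_le_of_additive
    (hdist : ∀ (n : ℕ) (a : ZMod (p ^ n)),
      ∑ b ∈ Finset.univ.filter (fun b : ZMod (p ^ (n + 1)) ↦
        ZMod.castHom (pow_dvd_pow p n.le_succ) (ZMod (p ^ n)) b = a), μ (n + 1) b = μ n a)
    {n L : ℕ} (h : n ≤ L) (a : ZMod (p ^ n)) (G : ZMod (p ^ n) → ℂ_[p]) :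
    ∑ b ∈ Finset.univ.filter (fun b : ZMod (p ^ L) ↦
      ZMod.castHom (pow_dvd_pow p h) (ZMod (p ^ n)) b = a), G a * μ L b = G a * μ n a := by
  obtain ⟨d, rfl⟩ := Nat.exists_eq_add_of_le h
  rw [← Finset.mul_sum, sum_fiber_add_of_additive μ hdist n d a]

/-- **`∑_{y mod p^L} G(y mod pⁿ) · μ_L(y) = ∑_{x mod pⁿ} G(x) · μ_n(x)`** for `n ≤ L` and an additive
system (group by the fibre; `G` is constant on it). [cite: MazurTateTeitelbaum1986Invent, §I.10–§I.11] -/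
theorem sum_mul_comp_castHom_of_additive
    (hdist : ∀ (n : ℕ) (a : ZMod (p ^ n)),
      ∑ b ∈ Finset.univ.filter (fun b : ZMod (p ^ (n + 1)) ↦
        ZMod.castHom (pow_dvd_pow p n.le_succ) (ZMod (p ^ n)) b = a), μ (n + 1) b = μ n a)
    {n L : ℕ} (h : n ≤ L) (G : ZMod (p ^ n) → ℂ_[p]) :
    ∑ y : ZMod (p ^ L), G (ZMod.castHom (pow_dvd_pow p h) (ZMod (p ^ n)) y) * μ L y =
      ∑ x : ZMod (p ^ n), G x * μ n x := by
  classical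
  set π := ZMod.castHom (pow_dvd_pow p h) (ZMod (p ^ n)) with hπ
  rw [← Finset.sum_fiberwise_of_maps_to (s := Finset.univ) (t := Finset.univ) (g := π)
    (fun x _ ↦ Finset.mem_univ (π x))]
  refine Finset.sum_congr rfl fun x _ ↦ ?_
  have hG : ∑ y ∈ Finset.univ.filter (fun y : ZMod (p ^ L) ↦ π y = x), G (π y) * μ L y =
      G x * ∑ y ∈ Finset.univ.filter (fun y : ZMod (p ^ L) ↦ π y = x), μ L y := by
    rw [Finset.mul_sum]
    refine Finset.sum_congr rfl fun y hy ↦ ?_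
    rw [(Finset.mem_filter.mp hy).2]
  rw [hG]
  have h1 := sum_fiber_le_of_additive μ hdist h x (fun _ ↦ (1 : ℂ_[p]))
  simp only [one_mul] at h1
  rw [h1]

/-- **Reduction to a lower level on UNITS**: for `1 ≤ m ≤ L` and an additive system,
`∑_{u ∈ (ℤ/p^L)ˣ} μ_L(u) · g(u mod p^m) = ∑_{a ∈ (ℤ/p^m)ˣ} μ_m(a) · g(a)` (units lie over units).
[cite: MazurTateTeitelbaum1986Invent, §I.10–§I.13] -/
theorem sum_units_mul_of_additive
    (hdist : ∀ (n : ℕ) (a : ZMod (p ^ n)),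
      ∑ b ∈ Finset.univ.filter (fun b : ZMod (p ^ (n + 1)) ↦
        ZMod.castHom (pow_dvd_pow p n.le_succ) (ZMod (p ^ n)) b = a), μ (n + 1) b = μ n a)
    {m L : ℕ} (hm : 1 ≤ m) (h : m ≤ L) (g : ZMod (p ^ m) → ℂ_[p]) :
    ∑ u : (ZMod (p ^ L))ˣ, μ L u * g (ZMod.castHom (pow_dvd_pow p h) (ZMod (p ^ m)) u) =
      ∑ a : (ZMod (p ^ m))ˣ, μ m a * g a := by
  classical
  haveI : NeZero (p ^ L) := ⟨pow_ne_zero _ (Fact.out : p.Prime).ne_zero⟩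
  haveI : NeZero (p ^ m) := ⟨pow_ne_zero _ (Fact.out : p.Prime).ne_zero⟩
  rw [sum_units_eq_sum_filter_isUnit (F := fun b : ZMod (p ^ L) ↦ μ L b *
      g (ZMod.castHom (pow_dvd_pow p h) (ZMod (p ^ m)) b)),
    sum_units_eq_sum_filter_isUnit (F := fun a : ZMod (p ^ m) ↦ μ m a * g a),
    ← Finset.sum_fiberwise (Finset.univ.filter fun b : ZMod (p ^ L) ↦ IsUnit b)
      (ZMod.castHom (pow_dvd_pow p h) (ZMod (p ^ m))), Finset.sum_filter]
  refine Finset.sum_congr rfl fun a _ ↦ ?_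
  split_ifs with ha
  · have hfil : (Finset.univ.filter fun b : ZMod (p ^ L) ↦ IsUnit b).filter
        (fun b ↦ ZMod.castHom (pow_dvd_pow p h) (ZMod (p ^ m)) b = a) =
        Finset.univ.filter (fun b ↦ ZMod.castHom (pow_dvd_pow p h) (ZMod (p ^ m)) b = a) := by
      ext b
      simp only [Finset.mem_filter, Finset.mem_univ, true_and, and_iff_right_iff_imp]
      intro hb
      rw [isUnit_iff_isUnit_castHom (p := p) hm h, hb]
      exact ha
    have h1 := sum_fiber_le_of_additive μ hdist h a (fun _ ↦ (1 : ℂ_[p]))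
    simp only [one_mul] at h1
    rw [hfil, ← h1, Finset.sum_mul]
    refine Finset.sum_congr rfl fun b hb ↦ ?_
    rw [(Finset.mem_filter.mp hb).2]
  · refine Finset.sum_eq_zero fun b hb ↦ ?_
    simp only [Finset.mem_filter, Finset.mem_univ, true_and] at hb
    exact absurd (hb.2 ▸ (isUnit_iff_isUnit_castHom (p := p) hm h b).mp hb.1) ha

end Additive

end Summit.BirchSwinnertonDyer.BirchSwinnertonDyer.Theorems.PSBallSystems
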